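import Summits.KontsevichZagierPeriods.KontsevichZagierPeriods.Theorems.RootDecompWalshStrataEulerDescent04

/-!
# Conic descent, gen 6 (L4 one-variable Euler descent `[T, R(x)·√(ex²+fx+g)^{±1}] ∈ InBaker`), part 5/12

Declarations `InBaker.euler_factor` … `sqrt_const_pole_core` of the farm-checked gen-6 monolith; see the module docstring of
`EulerDescent01` (part 1) for the overview, the design and the sources. [KontsevichZagier2001 §1.1–1.2; BCR1998 §2.2; Euler 1768; this node gen 4 `sqrtDescent_*`]
-/

noncomputable section

open Literature.NumberTheory.Transcendental
open MeasureTheory Set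
open MvPolynomial (aeval)
open Literature.ModelTheory.ExponentialFields (IsSemialgebraic isSemialgebraic_univ
  isSemialgebraic_setOf_eval_pos isSemialgebraic_setOf_eval_lt isSemialgebraic_setOf_eval_le
  isSemialgebraic_setOf_eval_nonneg isSemialgebraic_setOf_eval_eq_zero continuous_aeval_real
  tarski_seidenberg_real_holds)

namespace Summit.KontsevichZagierPeriods.RootDecompWalshStrata.ConicDescent

/-- The half-line `{t > 0}` is `ℚ`-semialgebraic (part-local `private` copy). [BCR1998 §2.2] -/
private theorem isSemialgebraic_pos' : IsSemialgebraic ℚ {v : Fin 1 → ℝ | 0 < v 0} := by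
  convert isSemialgebraic_setOf_eval_pos (k := ℚ) (R := ℝ)
    (MvPolynomial.X (0 : Fin 1) : MvPolynomial (Fin 1) ℚ) using 1
  ext v
  simp

/-- The half-line `{t > a}` is `ℚ`-semialgebraic (part-local `private` copy). [BCR1998 §2.2] -/
private theorem isSemialgebraic_gt' (a : ℚ) : IsSemialgebraic ℚ {v : Fin 1 → ℝ | (a : ℝ) < v 0} := by
  convert isSemialgebraic_setOf_eval_pos (k := ℚ) (R := ℝ)
    (MvPolynomial.X (0 : Fin 1) - MvPolynomial.C a : MvPolynomial (Fin 1) ℚ) using 1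
  ext v
  simp [sub_pos]

/-- **GENERAL RATIONAL FACTOR, genuinely quadratic radicand** (`e ≠ 0`, `h = g − f²/(4e) ≠ 0`):
`[T, R(x)·√(e x² + f x + g)] ∈ InBaker` for every `R = P/Q ∈ ℚ(x)` such that NEITHER `Q` NOR ITS
MIRROR IMAGE `Q(2x₀ − ·)` VANISHES on a compact interval `[a, b] ⊇ T` (no poles and no
"mirror poles" on the hull of the domain).  Proof: Euler's parity split `R(x) = E(u²) + u·O(u²)`,
`u = x − x₀` (`Parity.identity`), realised as rule (1b) `[T, R√D] = [T, E√D] + [T, uO√D]` (the even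
part is bounded on `[a, b]`, hence a representation via `bddRep`), then `InBaker.even_factor` and
`InBaker.odd_factor`.  [this node; Euler 1768 (Euler substitutions), KontsevichZagier2001 §1.2] -/
theorem InBaker.euler_factor (e f g : ℚ) (he : e ≠ 0) (hh : g - f ^ 2 / (4 * e) ≠ 0)
    (P Q : Polynomial ℚ) (a b : ℚ) (r : KZ.IntegralRep 1)
    (hab : ∀ v ∈ r.domain, (a : ℝ) ≤ v 0 ∧ v 0 ≤ b)
    (hQ : ∀ x : ℝ, (a : ℝ) ≤ x → x ≤ b → Polynomial.aeval x Q ≠ 0 ∧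
      Polynomial.aeval (2 * (((-f / (2 * e) : ℚ) : ℝ)) - x) Q ≠ 0)
    (hr : EqOn r.integrand (fun v => Polynomial.aeval (v 0) P / Polynomial.aeval (v 0) Q *
      √(qD e f g (v 0))) r.domain) :
    InBaker (KZ.of r) := by
  set x₀ : ℚ := -f / (2 * e) with hx₀def
  have key : ∀ x : ℝ, (a : ℝ) ≤ x → x ≤ b →
      Polynomial.aeval ((x - (x₀ : ℝ)) ^ 2) (Parity.den₂ x₀ Q) ≠ 0 ∧
        Polynomial.aeval x P / Polynomial.aeval x Q =
          (Polynomial.aeval ((x - (x₀ : ℝ)) ^ 2) (Parity.numE x₀ P Q) +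
            (x - (x₀ : ℝ)) * Polynomial.aeval ((x - (x₀ : ℝ)) ^ 2) (Parity.numO x₀ P Q)) /
            Polynomial.aeval ((x - (x₀ : ℝ)) ^ 2) (Parity.den₂ x₀ Q) := by
    intro x hxa hxb
    have h := Parity.identity x₀ P Q (x - x₀)
      (by rw [show (x₀ : ℝ) + (x - x₀) = x by ring]; exact (hQ x hxa hxb).1)
      (by rw [show (x₀ : ℝ) - (x - x₀) = 2 * x₀ - x by ring]; exact (hQ x hxa hxb).2)
    rwa [show (x₀ : ℝ) + (x - x₀) = x by ring] at h
  -- the even part `E((x − x₀)²)·√D`, a bounded semialgebraic function on the domain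
  obtain ⟨Fe, hFedef⟩ : ∃ Fe : (Fin 1 → ℝ) → ℝ, Fe = fun v =>
      Polynomial.aeval ((v 0 - (x₀ : ℝ)) ^ 2) (Parity.numE x₀ P Q) /
        Polynomial.aeval ((v 0 - (x₀ : ℝ)) ^ 2) (Parity.den₂ x₀ Q) * √(qD e f g (v 0)) :=
    ⟨_, rfl⟩
  have hFev : ∀ v : Fin 1 → ℝ, Fe v = Polynomial.aeval ((v 0 - (x₀ : ℝ)) ^ 2) (Parity.numE x₀ P Q) /
      Polynomial.aeval ((v 0 - (x₀ : ℝ)) ^ 2) (Parity.den₂ x₀ Q) * √(qD e f g (v 0)) :=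
    fun v => by rw [hFedef]
  have hQ₂ : ∀ v ∈ r.domain,
      Polynomial.aeval ((v 0 - (x₀ : ℝ)) ^ 2) (Parity.den₂ x₀ Q) ≠ 0 :=
    fun v hv => (key (v 0) (hab v hv).1 (hab v hv).2).1
  have hFe : IsSemialgebraicFunOn ℚ r.domain Fe := by
    have hu : IsRatOn r.domain fun v => (v 0 - (x₀ : ℝ)) ^ 2 :=
      (IsRatOn.coord.sub (IsRatOn.const x₀)).pow 2
    have h1 := (hu.polyAeval (Parity.numE x₀ P Q)).div (hu.polyAeval (Parity.den₂ x₀ Q)) hQ₂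
    exact ((h1.isSemialgebraicFunOn r.isSemialgebraic_domain).mul_holds
      (IsSemialgebraicFunOn.sqrt_holds
        (isSemialgebraicFunOn_qD e f g r.isSemialgebraic_domain))).congr
      fun v _ => by simp only [Pi.mul_apply, hFev]
  have hcont : ContinuousOn (fun x : ℝ =>
      Polynomial.aeval ((x - (x₀ : ℝ)) ^ 2) (Parity.numE x₀ P Q) /
        Polynomial.aeval ((x - (x₀ : ℝ)) ^ 2) (Parity.den₂ x₀ Q) * √(qD e f g x))
      (Icc (a : ℝ) b) := by
    have h1 : Continuous fun x : ℝ =>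
        Polynomial.aeval ((x - (x₀ : ℝ)) ^ 2) (Parity.numE x₀ P Q) := by
      fun_prop
    have h2 : Continuous fun x : ℝ =>
        Polynomial.aeval ((x - (x₀ : ℝ)) ^ 2) (Parity.den₂ x₀ Q) := by
      fun_prop
    have h3 : Continuous fun x : ℝ => √(qD e f g x) := by unfold qD; fun_prop
    exact (h1.continuousOn.div h2.continuousOn fun x hx => (key x hx.1 hx.2).1).mul
      h3.continuousOn
  obtain ⟨M, hM⟩ :=
    (isCompact_Icc : IsCompact (Icc (a : ℝ) b)).exists_bound_of_continuousOn hcont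
  have hbdd : Bornology.IsBounded r.domain := by
    refine (Metric.isBounded_Icc (fun _ : Fin 1 => (a : ℝ)) fun _ => (b : ℝ)).subset
      fun v hv => ?_
    exact ⟨fun i => by rw [Subsingleton.elim i 0]; exact (hab v hv).1,
      fun i => by rw [Subsingleton.elim i 0]; exact (hab v hv).2⟩
  obtain ⟨rE, hrEdef⟩ : ∃ rE : KZ.IntegralRep 1, rE = bddRep r.domain r.isSemialgebraic_domain
      hbdd Fe hFe M fun v hv => by
        rw [hFev, ← Real.norm_eq_abs]; exact hM (v 0) ⟨(hab v hv).1, (hab v hv).2⟩ :=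
    ⟨_, rfl⟩
  have hdomE : rE.domain = r.domain := by rw [hrEdef]; rfl
  have hintE : rE.integrand = Fe := by rw [hrEdef]; rfl
  refine InBaker.of_sub' r rE hdomE ?_ ?_
  · -- the even part
    refine InBaker.even_factor e f g he hh (Parity.numE x₀ P Q) (Parity.den₂ x₀ Q) rE
      (fun v hv => hQ₂ v (by rw [hdomE] at hv; exact hv)) fun v _ => ?_
    rw [hintE, hFev]
  · -- the odd part `(x − x₀)·O((x − x₀)²)·√D`
    refine InBaker.odd_factor e f g he (Parity.numO x₀ P Q) (Parity.den₂ x₀ Q)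
      (subRep r rE hdomE) (fun v hv => hQ₂ v hv) fun v hv => ?_
    have hv' : v ∈ r.domain := hv
    rw [subRep_integrand, hintE, hFev, hr hv']
    beta_reduce
    rw [(key (v 0) (hab v hv').1 (hab v hv').2).2]
    ring

/-! #### 24.6 The mirror-pole atom `c·√D/((x − a)·D)`: INVERSION `x = a + 1/z` about the pole -/

/-- INVERSION `x = a + 1/z` about a rational point (rule (2)), callback form: the pulled-back
representation lives on `{z ∈ T₀ : a + 1/z ∈ T}` with integrand `z ↦ f(a + 1/z)/z²`.
[KontsevichZagier2001 §1.2 rule (2)] -/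
theorem InBaker.of_invert' (a : ℚ) (r' : KZ.IntegralRep 1) {T₀ : Set (Fin 1 → ℝ)}
    (hT₀ : IsSemialgebraic ℚ T₀) (hT₀0 : ∀ v ∈ T₀, v 0 ≠ 0)
    (hcov : ∀ x ∈ r'.domain, x 0 ≠ a ∧ (fun _ : Fin 1 => (x 0 - a)⁻¹) ∈ T₀)
    (R : (Fin 1 → ℝ) → ℝ) (hR : IsSemialgebraicFunOn ℚ T₀ R)
    (hRe : ∀ v ∈ T₀, (fun _ : Fin 1 => (a : ℝ) + (v 0)⁻¹) ∈ r'.domain →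
      R v = r'.integrand (fun _ : Fin 1 => (a : ℝ) + (v 0)⁻¹) / v 0 ^ 2)
    (h : ∀ r : KZ.IntegralRep 1,
      r.domain = {v | v ∈ T₀ ∧ (fun _ : Fin 1 => (a : ℝ) + (v 0)⁻¹) ∈ r'.domain} →
      r.integrand = R → InBaker (KZ.of r)) :
    InBaker (KZ.of r') := by
  have hgS : IsSemialgebraicFunOn ℚ T₀ fun v => (a : ℝ) + (v 0)⁻¹ :=
    ((IsRatOn.const a).add (IsRatOn.coord.inv hT₀0)).isSemialgebraicFunOn hT₀
  have hlift : ∀ v : Fin 1 → ℝ, lift₁ (fun t : ℝ => (a : ℝ) + t⁻¹) v =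
      fun _ => (a : ℝ) + (v 0)⁻¹ := fun v => rfl
  refine InBaker.of_cov₁' r' hT₀ (fun t : ℝ => (a : ℝ) + t⁻¹) (fun t => -(t ^ 2)⁻¹) hgS
    (fun v hv => (hasDerivAt_inv (hT₀0 v hv)).const_add (a : ℝ))
    (fun s _ t _ hst => by simpa using hst)
    (fun x hx => ⟨fun _ => (x 0 - a)⁻¹, (hcov x hx).2, by simp⟩) R hR
    (fun v hv hvd => by
      rw [hlift] at hvd
      rw [hlift, hRe v hv hvd, abs_neg, abs_inv, abs_of_nonneg (sq_nonneg _), div_eq_mul_inv])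
    fun r hrd hri => h r (by simp only [hrd, hlift]) hri

/-- **The mirror-pole atom, right of the pole.**  For `e ≠ 0`, `h ≠ 0`, a RATIONAL point `a` with
`D(a) ≠ 0` and a domain inside `{x > a, D > 0}`:  `[T, c·√D/((x − a)·D(x))] ∈ InBaker`.  The
INVERSION `x = a + 1/z` (`z > 0`) turns `c·dx/((x − a)√D(x))` into `c·dz/√D̃(z)` with the new conic
`D̃(z) = z²·D(a + 1/z) = D(a)·z² + D′(a)·z + e` (`e ↦ D(a) ≠ 0`,
`h ↦ e − D′(a)²/(4D(a)) = e·h/D(a) ≠ 0`), i.e. into the EVEN factor `(c/D̃(z))·√D̃(z)`, to which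
`InBaker.even_factor` applies (`D̃ > 0` on the chart domain).  This is the atom whose parity split
fails when the mirror point `2x₀ − a` lies on the hull of `T`. [this node] -/
theorem InBaker.mirror_atom_right (e f g a c : ℚ) (he : e ≠ 0) (hh : g - f ^ 2 / (4 * e) ≠ 0)
    (hDa : e * a ^ 2 + f * a + g ≠ 0) (r : KZ.IntegralRep 1)
    (hdom : ∀ v ∈ r.domain, (a : ℝ) < v 0 ∧ 0 < qD e f g (v 0))
    (hr : EqOn r.integrand (fun v => (c : ℝ) / ((v 0 - a) * qD e f g (v 0)) * √(qD e f g (v 0)))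
      r.domain) :
    InBaker (KZ.of r) := by
  obtain ⟨Da, hDadef⟩ : ∃ Da : ℚ, Da = e * a ^ 2 + f * a + g := ⟨_, rfl⟩
  obtain ⟨f₁, hf₁def⟩ : ∃ f₁ : ℚ, f₁ = 2 * e * a + f := ⟨_, rfl⟩
  have hDa0 : Da ≠ 0 := by rw [hDadef]; exact hDa
  have hh₁ : e - f₁ ^ 2 / (4 * Da) ≠ 0 := by
    have h4 : e - f₁ ^ 2 / (4 * Da) = (4 * e * Da - f₁ ^ 2) / (4 * Da) := by
      field_simp
    have h5 : 4 * e * Da - f₁ ^ 2 = 4 * e * (g - f ^ 2 / (4 * e)) := by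
      rw [hDadef, hf₁def]
      field_simp
      ring
    rw [h4, h5]
    exact div_ne_zero (mul_ne_zero (mul_ne_zero four_ne_zero he) hh)
      (mul_ne_zero four_ne_zero hDa0)
  have hDt : ∀ z : ℝ, z ≠ 0 → qD Da f₁ e z = z ^ 2 * qD e f g ((a : ℝ) + z⁻¹) := fun z hz => by
    rw [hDadef, hf₁def]; simp only [qD]; push_cast; field_simp; ring
  have hT₀ : IsSemialgebraic ℚ
      {v : Fin 1 → ℝ | v ∈ {v : Fin 1 → ℝ | 0 < v 0} ∧ 0 < qD Da f₁ e (v 0)} :=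
    IsSemialgebraicFunOn.isSemialgebraic_sep_pos
      (isSemialgebraicFunOn_qD Da f₁ e isSemialgebraic_pos')
  have hQv : ∀ z : ℝ, Polynomial.aeval ((z - ((-f₁ / (2 * Da) : ℚ) : ℝ)) ^ 2)
      (Polynomial.C Da * Polynomial.X + Polynomial.C (e - f₁ ^ 2 / (4 * Da))) =
        qD Da f₁ e z := fun z => by
    rw [qD_eq_vertex Da f₁ e hDa0 z]
    simp only [map_add, map_mul, Polynomial.aeval_C, Polynomial.aeval_X, eq_ratCast]
  refine InBaker.of_invert' a r hT₀ (fun v hv => (show (0 : ℝ) < v 0 from hv.1).ne')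
    (fun x hx => ?_) (fun v => (c : ℝ) / qD Da f₁ e (v 0) * √(qD Da f₁ e (v 0))) ?_
    (fun v hv hvd => ?_) fun r₃ hd₃ hi₃ => ?_
  · -- the chart covers the domain: `z = 1/(x − a) > 0` and `D̃(z) = z²·D(x) > 0`
    obtain ⟨hxa, hxD⟩ := hdom x hx
    have hxa' : x 0 - a ≠ 0 := sub_ne_zero.2 hxa.ne'
    refine ⟨hxa.ne', inv_pos.2 (sub_pos.2 hxa), ?_⟩
    change 0 < qD Da f₁ e (x 0 - a)⁻¹
    rw [hDt _ (inv_ne_zero hxa'), inv_inv, show (a : ℝ) + (x 0 - a) = x 0 by ring]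
    exact mul_pos (pow_pos (inv_pos.2 (sub_pos.2 hxa)) 2) hxD
  · -- the pulled-back integrand is semialgebraic on the chart domain
    have h1 : IsRatOn {v : Fin 1 → ℝ | v ∈ {v : Fin 1 → ℝ | 0 < v 0} ∧ 0 < qD Da f₁ e (v 0)}
        fun v => (c : ℝ) / qD Da f₁ e (v 0) :=
      (IsRatOn.const c).div (IsRatOn.quad Da f₁ e) fun v hv => hv.2.ne'
    exact ((h1.isSemialgebraicFunOn hT₀).mul_holds (IsSemialgebraicFunOn.sqrt_holds
      (isSemialgebraicFunOn_qD Da f₁ e hT₀))).congr fun v _ => by simp only [Pi.mul_apply]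
  · -- the pull-back: `c/((x − a)D(x))·√D(x)·(1/z²) = (c/D̃(z))·√D̃(z)` for `z > 0`
    have hz : (0 : ℝ) < v 0 := hv.1
    rw [hr hvd]
    beta_reduce
    have hDx : qD e f g ((a : ℝ) + (v 0)⁻¹) = qD Da f₁ e (v 0) / v 0 ^ 2 := by
      rw [hDt _ hz.ne', mul_div_cancel_left₀ _ (pow_ne_zero 2 hz.ne')]
    rw [show (a : ℝ) + (v 0)⁻¹ - a = (v 0)⁻¹ by ring, hDx, Real.sqrt_div' _ (sq_nonneg _),
      Real.sqrt_sq hz.le]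
    have hD0 : qD Da f₁ e (v 0) ≠ 0 := (show 0 < qD Da f₁ e (v 0) from hv.2).ne'
    have hz0 : v 0 ≠ 0 := hz.ne'
    field_simp
  · -- the pulled-back representation is an even factor for the conic `D̃`
    refine InBaker.even_factor Da f₁ e hDa0 hh₁ (Polynomial.C c)
      (Polynomial.C Da * Polynomial.X + Polynomial.C (e - f₁ ^ 2 / (4 * Da))) r₃
      (fun v hv => ?_) fun v hv => ?_
    · rw [hd₃] at hv; rw [hQv]; exact (show 0 < qD Da f₁ e (v 0) from hv.1.2).ne'
    · rw [hi₃]; beta_reduce; rw [hQv, Polynomial.aeval_C, eq_ratCast]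

/-- **THE MIRROR-POLE ATOM** on an arbitrary domain: for `e ≠ 0`, `h ≠ 0` and a rational point `a`
with `D(a) ≠ 0`, `[T, c·√D/((x − a)·D(x))] ∈ InBaker`.  Restrict to `{D > 0}`, split at `a`
(rule (1a), the point is null); right of `a` use `mirror_atom_right`; left of `a` REFLECT
`x = 2a − t`, which carries `D` to `D₂(t) = D(2a − t) = e t² − (4ea + f) t + (4ea² + 2fa + g)`
(same `e`, same `h`, `D₂(a) = D(a)`) and the integrand to `(−c)·√D₂/((t − a)·D₂(t))` on a domain
right of `a`.  Together with partial fractions this removes the "mirror-pole" restriction of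
`InBaker.euler_factor` for RATIONAL simple poles: `c/(x − a) = c·(e(x − a) + D′(a))/D(x) +
c·D(a)/((x − a)·D(x))`. [this node] -/
theorem InBaker.mirror_atom (e f g a c : ℚ) (he : e ≠ 0) (hh : g - f ^ 2 / (4 * e) ≠ 0)
    (hDa : e * a ^ 2 + f * a + g ≠ 0) (r : KZ.IntegralRep 1)
    (hr : EqOn r.integrand (fun v => (c : ℝ) / ((v 0 - a) * qD e f g (v 0)) * √(qD e f g (v 0)))
      r.domain) :
    InBaker (KZ.of r) := by
  refine InBaker.restrict_pos e f g r _ hr fun r₁ hsub hpos hr₁ => ?_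
  refine InBaker.of_split_at a r₁ (fun r₂ hd₂ hi₂ => ?_) fun r₂ hd₂ hi₂ => ?_
  · -- right of the pole
    refine InBaker.mirror_atom_right e f g a c he hh hDa r₂ (fun v hv => ?_) fun v hv => ?_
    · rw [hd₂] at hv; exact ⟨hv.2, hpos v hv.1⟩
    · rw [hd₂] at hv; rw [hi₂]; exact hr₁ hv.1
  · -- left of the pole: reflect `x = 2a − t`
    obtain ⟨f', hf'def⟩ : ∃ f' : ℚ, f' = -(4 * e * a + f) := ⟨_, rfl⟩
    obtain ⟨g', hg'def⟩ : ∃ g' : ℚ, g' = 4 * e * a ^ 2 + 2 * f * a + g := ⟨_, rfl⟩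
    have hh' : g' - f' ^ 2 / (4 * e) ≠ 0 := by
      have h4 : g' - f' ^ 2 / (4 * e) = g - f ^ 2 / (4 * e) := by
        rw [hf'def, hg'def]; field_simp; ring
      rw [h4]; exact hh
    have hDa' : e * a ^ 2 + f' * a + g' ≠ 0 := by
      have h4 : e * a ^ 2 + f' * a + g' = e * a ^ 2 + f * a + g := by rw [hf'def, hg'def]; ring
      rw [h4]; exact hDa
    have hrefl : ∀ x : ℝ, qD e f g (2 * (a : ℝ) - x) = qD e f' g' x := fun x => by
      rw [hf'def, hg'def]; simp only [qD]; push_cast; ring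
    have hc2 : (((2 * a : ℚ)) : ℝ) = 2 * (a : ℝ) := by push_cast; ring
    have hT₀ : IsSemialgebraic ℚ
        {v : Fin 1 → ℝ | v ∈ {v : Fin 1 → ℝ | (a : ℝ) < v 0} ∧ 0 < qD e f' g' (v 0)} :=
      IsSemialgebraicFunOn.isSemialgebraic_sep_pos
        (isSemialgebraicFunOn_qD e f' g' (isSemialgebraic_gt' a))
    refine InBaker.of_reflect' (2 * a) r₂ hT₀ (fun x hx => ?_)
      (fun v => ((-c : ℚ) : ℝ) / ((v 0 - a) * qD e f' g' (v 0)) * √(qD e f' g' (v 0))) ?_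
      (fun v hv hvd => ?_) fun r₃ hd₃ hi₃ => ?_
    · -- the mirror image of the left piece lies right of `a` inside `{D₂ > 0}`
      rw [hd₂] at hx
      obtain ⟨hx₁, hxlt⟩ := hx
      refine ⟨?_, ?_⟩
      · change (a : ℝ) < (((2 * a : ℚ)) : ℝ) - x 0
        rw [hc2]; linarith
      · change 0 < qD e f' g' ((((2 * a : ℚ)) : ℝ) - x 0)
        rw [hc2, ← hrefl, sub_sub_cancel]
        exact hpos x hx₁
    · -- semialgebraic integrand on the mirror domain
      have h1 : IsRatOn
          {v : Fin 1 → ℝ | v ∈ {v : Fin 1 → ℝ | (a : ℝ) < v 0} ∧ 0 < qD e f' g' (v 0)}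
          fun v => ((-c : ℚ) : ℝ) / ((v 0 - a) * qD e f' g' (v 0)) :=
        (IsRatOn.const (-c)).div ((IsRatOn.coord.sub (IsRatOn.const a)).mul
          (IsRatOn.quad e f' g')) fun v hv =>
            mul_ne_zero (sub_ne_zero.2 (show (a : ℝ) < v 0 from hv.1).ne') hv.2.ne'
      exact ((h1.isSemialgebraicFunOn hT₀).mul_holds (IsSemialgebraicFunOn.sqrt_holds
        (isSemialgebraicFunOn_qD e f' g' hT₀))).congr fun v _ => by simp only [Pi.mul_apply]
    · -- the reflected integrand
      have hvd' : (fun _ : Fin 1 => (((2 * a : ℚ)) : ℝ) - v 0) ∈ r₁.domain := by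
        rw [hd₂] at hvd; exact hvd.1
      rw [hi₂, hr₁ hvd']
      beta_reduce
      rw [hc2, hrefl, show 2 * (a : ℝ) - v 0 - a = -(v 0 - a) by ring, neg_mul, div_neg]
      push_cast
      ring
    · -- the reflected piece is a right-of-the-pole atom for `D₂` with constant `−c`
      refine InBaker.mirror_atom_right e f' g' a (-c) he hh' hDa' r₃ (fun v hv => ?_)
        fun v hv => ?_
      · rw [hd₃] at hv; exact ⟨hv.1.1, hv.1.2⟩
      · rw [hi₃]


/-! #### 24.7 The degenerate strata: the atom `c·√m/(x − a)` by a MÖBIUS chart with irrational coefficients -/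

/-- Core of `InBaker.sqrt_const_pole`: the Möbius chart `x = a + (t + √m)/(t − √m)` on
`T₀ = {t² ≠ m}` for a domain avoiding `x = a` and `x = a + 1`. [this node] -/
theorem sqrt_const_pole_core (m a c : ℚ) (hm : 0 < m) (r' : KZ.IntegralRep 1)
    (hcov : ∀ x ∈ r'.domain, x 0 - a ≠ 0 ∧ x 0 - a ≠ 1)
    (hr : EqOn r'.integrand (fun v => (c : ℝ) / (v 0 - a) * √(qD 0 0 m (v 0))) r'.domain) :
    InBaker (KZ.of r') := by
  obtain ⟨ρ, hρdef⟩ : ∃ ρ : ℝ, ρ = √(m : ℝ) := ⟨_, rfl⟩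
  have hm' : (0 : ℝ) < m := by exact_mod_cast hm
  have hρ : 0 < ρ := by rw [hρdef]; exact Real.sqrt_pos.2 hm'
  have hρ2 : ρ ^ 2 = (m : ℝ) := by rw [hρdef]; exact Real.sq_sqrt hm'.le
  have hfac : ∀ t : ℝ, t ^ 2 - (m : ℝ) = (t + ρ) * (t - ρ) := fun t => by rw [← hρ2]; ring
  have hqD : ∀ x : ℝ, qD 0 0 m x = m := fun x => by simp [qD]
  obtain ⟨T₀, hT₀def⟩ : ∃ T₀ : Set (Fin 1 → ℝ),
      T₀ = {v | v ∈ (univ : Set (Fin 1 → ℝ)) ∧ v 0 ^ 2 - (m : ℝ) ≠ 0} := ⟨_, rfl⟩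
  have hT₀ : IsSemialgebraic ℚ T₀ := by
    rw [hT₀def]
    exact IsRatOn.isSemialgebraic_sep_ne_zero isSemialgebraic_univ
      ((IsRatOn.coord.pow 2).sub (IsRatOn.const m))
  have hT₀' : ∀ v ∈ T₀, v 0 + ρ ≠ 0 ∧ v 0 - ρ ≠ 0 := fun v hv => by
    rw [hT₀def] at hv
    have h := hv.2
    rw [hfac] at h
    exact ⟨left_ne_zero_of_mul h, right_ne_zero_of_mul h⟩
  -- the Möbius chart is `ℚ`-semialgebraic (its only irrational ingredient is `√m`)
  have hgS : IsSemialgebraicFunOn ℚ T₀ fun v => (a : ℝ) + (v 0 + ρ) / (v 0 - ρ) := by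
    have hsq : IsSemialgebraicFunOn ℚ T₀ fun _ : Fin 1 → ℝ => ρ :=
      (IsSemialgebraicFunOn.sqrt_holds (isSemialgebraicFunOn_ratCast hT₀ m)).congr
        fun v _ => by rw [hρdef]
    have hx := isSemialgebraicFunOn_apply hT₀ 0
    have hnum : IsSemialgebraicFunOn ℚ T₀ fun v : Fin 1 → ℝ => v 0 + ρ :=
      (hx.add_holds hsq).congr fun v _ => by simp only [Pi.add_apply]
    have hden : IsSemialgebraicFunOn ℚ T₀ fun v : Fin 1 → ℝ => v 0 - ρ :=
      (hx.sub_holds hsq).congr fun v _ => by simp only [Pi.sub_apply]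
    exact ((isSemialgebraicFunOn_ratCast hT₀ a).add_holds
      (hnum.div hden fun v hv => (hT₀' v hv).2)).congr fun v _ => by simp only [Pi.add_apply]
  refine InBaker.of_cov₁_rat r' hT₀ (fun t : ℝ => (a : ℝ) + (t + ρ) / (t - ρ))
    (fun t => (1 * (t - ρ) - (t + ρ) * 1) / (t - ρ) ^ 2) hgS (fun v hv => ?_)
    (fun s hs t ht hst => ?_) (fun x hx => ?_)
    (fun v => ((2 * c * m : ℚ) : ℝ) / (v 0 ^ 2 - m)) ?_ fun v hv hvd => ?_
  · -- derivative of the Möbius map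
    exact (((hasDerivAt_id' (v 0)).add_const ρ).div ((hasDerivAt_id' (v 0)).sub_const ρ)
      (hT₀' v hv).2).const_add (a : ℝ)
  · -- injectivity on `T₀`
    have hs' := (hT₀' s hs).2
    have ht' := (hT₀' t ht).2
    have h1 : (s 0 + ρ) / (s 0 - ρ) = (t 0 + ρ) / (t 0 - ρ) := by
      have h := hst
      simp only [add_right_inj] at h
      exact h
    rw [div_eq_div_iff hs' ht'] at h1
    have h2 : 2 * ρ * (t 0 - s 0) = 0 := by linear_combination h1
    have h3 : t 0 - s 0 = 0 := (mul_eq_zero.1 h2).resolve_left (mul_ne_zero two_ne_zero hρ.ne')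
    exact (sub_eq_zero.1 h3).symm
  · -- surjectivity: `t = √m·(y + 1)/(y − 1)`, `y = x − a ∉ {0, 1}`
    obtain ⟨hy0, hy1⟩ := hcov x hx
    have hy1' : x 0 - a - 1 ≠ 0 := sub_ne_zero.2 hy1
    have ht1 : ρ * (x 0 - a + 1) / (x 0 - a - 1) + ρ = 2 * ρ * (x 0 - a) / (x 0 - a - 1) := by
      field_simp
      ring
    have ht2 : ρ * (x 0 - a + 1) / (x 0 - a - 1) - ρ = 2 * ρ / (x 0 - a - 1) := by
      field_simp
      ring
    refine ⟨fun _ => ρ * (x 0 - a + 1) / (x 0 - a - 1), ?_, ?_⟩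
    · rw [hT₀def]
      refine ⟨mem_univ _, ?_⟩
      change (ρ * (x 0 - a + 1) / (x 0 - a - 1)) ^ 2 - (m : ℝ) ≠ 0
      rw [hfac, ht1, ht2]
      exact mul_ne_zero (div_ne_zero (mul_ne_zero (mul_ne_zero two_ne_zero hρ.ne') hy0) hy1')
        (div_ne_zero (mul_ne_zero two_ne_zero hρ.ne') hy1')
    · change (a : ℝ) + (ρ * (x 0 - a + 1) / (x 0 - a - 1) + ρ) /
        (ρ * (x 0 - a + 1) / (x 0 - a - 1) - ρ) = x 0
      rw [ht1, ht2]
      have hρ0 : ρ ≠ 0 := hρ.ne'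
      field_simp
      ring
  · -- the pull-back is a rational function on `T₀`
    exact (IsRatOn.const (2 * c * m)).div ((IsRatOn.coord.pow 2).sub (IsRatOn.const m))
      fun v hv => by rw [hT₀def] at hv; exact hv.2
  · -- the pull-back computation `c√m/(x − a)·|dx/dt| = 2cm/(t² − m)`
    have hv' := hT₀' v hv
    have hx' : r'.integrand (lift₁ (fun t : ℝ => (a : ℝ) + (t + ρ) / (t - ρ)) v) =
        (c : ℝ) / ((a : ℝ) + (v 0 + ρ) / (v 0 - ρ) - a) *
          √(qD 0 0 m ((a : ℝ) + (v 0 + ρ) / (v 0 - ρ))) := hr hvd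
    have hg' : (1 * (v 0 - ρ) - (v 0 + ρ) * 1) / (v 0 - ρ) ^ 2 = -(2 * ρ / (v 0 - ρ) ^ 2) := by
      ring
    have hpos : 0 < 2 * ρ / (v 0 - ρ) ^ 2 :=
      div_pos (mul_pos two_pos hρ) (lt_of_le_of_ne (sq_nonneg _) (pow_ne_zero 2 hv'.2).symm)
    rw [hx', hqD, ← hρdef, add_sub_cancel_left, hg', abs_neg, abs_of_pos hpos]
    have h1 := hv'.1
    have h2 := hv'.2
    push_cast
    rw [← hρ2, show v 0 ^ 2 - ρ ^ 2 = (v 0 + ρ) * (v 0 - ρ) by ring]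
    field_simp

end Summit.KontsevichZagierPeriods.RootDecompWalshStrata.ConicDescent
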